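import Mathlib.MeasureTheory.Measure.Real
import HarnessLib

/-!
# Cross-multiplied versus quenched form of a conditional forgetting bound

Crux `Summit.CriticalPhenomena.CardyFormulaZ2.Theses.CardyMagicRigidity.NestingRigidity`
(stmt-CriticalPhenomena-4835), line `pinch-resampling` v2, helper shared by the registered stubs
`stub_fourArmCouplingT : FourArmCouplingT` (S2, site percolation on `𝕋`) and
`stub_fourArmCouplingZ2 : FourArmCouplingZ2` (S3, bond percolation on `ℤ²`).

Both stubs assert an "exterior forgetting" property of a conditioning event `A` (four alternating arms)
in CROSS-MULTIPLIED total-variation form: for exterior events `F, F'` and an interior event `E`,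
`|μ(E ∩ A ∩ F) μ(A ∩ F') - μ(E ∩ A ∩ F') μ(A ∩ F)| ≤ b μ(A ∩ F) μ(A ∩ F')`.
The published coupling statements (Garban–Pete–Schramm, arXiv:1008.1378, Prop. 11) are QUENCHED: the
conditional probability of `E` given `A ∩ F` is within `b` of a reference value `ν` not depending on `F`,
`|μ(E ∩ A ∩ F) - ν μ(A ∩ F)| ≤ (b/2) μ(A ∩ F)`.  This file records, for an arbitrary measure `μ` on an
arbitrary measurable space (so that both the site and the bond worker can use it verbatim), the
elementary passage between the two forms:

* `abs_mul_sub_mul_le_of_abs_sub_le` — the real-number core: two quenched bounds with the same reference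
  value give the cross-multiplied bound (expand `p q' - p' q = (p - ν q) q' - (p' - ν q') q`);
* `abs_crossMul_le_of_quenched` — the same for `μ.real` of the four intersections (registered anchor);
* `abs_sub_div_mul_le_of_abs_mul_sub_mul_le`, `quenched_of_abs_crossMul_le` — conversely, the
  cross-multiplied bound with `F' = univ` gives the quenched bound with reference value
  `ν = μ(E ∩ A) / μ(A)` (and constant `b` instead of `b / 2`).
-/

namespace Summit.CriticalPhenomena.CardyFormulaZ2.Cruxes.NestingRigidity.PinchResampling

open MeasureTheory Set

/-! ## §1 The real-number core -/

/-- **Quenched ⇒ cross-multiplied** for real numbers: if `p` is within `(b/2) q` of `ν q` and `p'` within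
`(b/2) q'` of `ν q'` (`q, q' ≥ 0`), then `|p q' - p' q| ≤ b q q'` — expand
`p q' - p' q = (p - ν q) q' - (p' - ν q') q`. -/
theorem abs_mul_sub_mul_le_of_abs_sub_le {p q p' q' ν b : ℝ} (hq : 0 ≤ q) (hq' : 0 ≤ q')
    (h : |p - ν * q| ≤ b / 2 * q) (h' : |p' - ν * q'| ≤ b / 2 * q') :
    |p * q' - p' * q| ≤ b * q * q' := by
  have key : p * q' - p' * q = (p - ν * q) * q' - (p' - ν * q') * q := by ring
  rw [key]
  calc |(p - ν * q) * q' - (p' - ν * q') * q|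
      ≤ |(p - ν * q) * q'| + |(p' - ν * q') * q| := abs_sub _ _
    _ = |p - ν * q| * q' + |p' - ν * q'| * q := by
        rw [abs_mul, abs_mul, abs_of_nonneg hq, abs_of_nonneg hq']
    _ ≤ b / 2 * q * q' + b / 2 * q' * q := by
        gcongr
    _ = b * q * q' := by ring

/-- **Cross-multiplied ⇒ quenched** for real numbers: if `0 ≤ p ≤ q`, `0 ≤ q₀`, `q₀ = 0 → q = 0` and
`|p q₀ - p₀ q| ≤ b q q₀`, then `|p - (p₀ / q₀) q| ≤ b q` (divide by `q₀`; if `q₀ = 0` everything vanishes). -/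
theorem abs_sub_div_mul_le_of_abs_mul_sub_mul_le {p q p₀ q₀ b : ℝ} (hp : 0 ≤ p) (hpq : p ≤ q)
    (hq₀ : 0 ≤ q₀) (hqq₀ : q₀ = 0 → q = 0) (h : |p * q₀ - p₀ * q| ≤ b * q * q₀) :
    |p - p₀ / q₀ * q| ≤ b * q := by
  rcases hq₀.eq_or_lt with h0 | h0
  · have hq : q = 0 := hqq₀ h0.symm
    have hp0 : p = 0 := le_antisymm (hq ▸ hpq) hp
    simp [hq, hp0]
  · have h1 : p - p₀ / q₀ * q = (p * q₀ - p₀ * q) / q₀ := by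
      field_simp
    rw [h1, abs_div, abs_of_pos h0, div_le_iff₀ h0]
    simpa [mul_comm, mul_left_comm, mul_assoc] using h

/-! ## §2 The measure-theoretic forms -/

variable {α : Type*} [MeasurableSpace α]

/-- **Quenched ⇒ cross-multiplied (registered helper of stubs S2/S3).**  For a measure `μ`, a conditioning
event `A`, an interior event `E`, two exterior events `F, F'` and a reference value `ν`: if the probability
of `E ∩ A ∩ F` is within `(b/2) μ(A ∩ F)` of `ν μ(A ∩ F)`, and likewise for `F'`, then
`|μ(E ∩ A ∩ F) μ(A ∩ F') - μ(E ∩ A ∩ F') μ(A ∩ F)| ≤ b μ(A ∩ F) μ(A ∩ F')`.  No measurability, finiteness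
or positivity assumption is needed (`μ.real` is nonnegative). -/
theorem abs_crossMul_le_of_quenched : ∀ (μ : MeasureTheory.Measure α) (A E F F' : Set α) (ν b : ℝ), |μ.real (E ∩ A ∩ F) - ν * μ.real (A ∩ F)| ≤ b / 2 * μ.real (A ∩ F) → |μ.real (E ∩ A ∩ F') - ν * μ.real (A ∩ F')| ≤ b / 2 * μ.real (A ∩ F') → |μ.real (E ∩ A ∩ F) * μ.real (A ∩ F') - μ.real (E ∩ A ∩ F') * μ.real (A ∩ F)| ≤ b * μ.real (A ∩ F) * μ.real (A ∩ F') :=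
  fun _ _ _ _ _ _ _ h h' ↦ abs_mul_sub_mul_le_of_abs_sub_le measureReal_nonneg measureReal_nonneg h h'

/-- **Cross-multiplied ⇒ quenched.**  For a finite measure `μ`, the cross-multiplied bound with second
exterior event `F' = univ`, i.e. `|μ(E ∩ A ∩ F) μ(A) - μ(E ∩ A) μ(A ∩ F)| ≤ b μ(A ∩ F) μ(A)`, gives the
quenched bound with the conditional probability `ν = μ(E ∩ A) / μ(A)` as reference value:
`|μ(E ∩ A ∩ F) - ν μ(A ∩ F)| ≤ b μ(A ∩ F)`. -/
theorem quenched_of_abs_crossMul_le (μ : Measure α) [IsFiniteMeasure μ] {A E F : Set α} {b : ℝ}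
    (h : |μ.real (E ∩ A ∩ F) * μ.real A - μ.real (E ∩ A) * μ.real (A ∩ F)| ≤
      b * μ.real (A ∩ F) * μ.real A) :
    |μ.real (E ∩ A ∩ F) - μ.real (E ∩ A) / μ.real A * μ.real (A ∩ F)| ≤ b * μ.real (A ∩ F) :=
  abs_sub_div_mul_le_of_abs_mul_sub_mul_le measureReal_nonneg
    (measureReal_mono (fun _ h ↦ ⟨h.1.2, h.2⟩)) measureReal_nonneg
    (fun h0 ↦ le_antisymm ((measureReal_mono inter_subset_left).trans_eq h0) measureReal_nonneg) h

/-- The cross-multiplied bound instantiated at `F' = univ` has the shape used in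
`quenched_of_abs_crossMul_le` (rewrite `A ∩ univ = A`, `E ∩ A ∩ univ = E ∩ A`). -/
theorem quenched_of_abs_crossMul_le_univ (μ : Measure α) [IsFiniteMeasure μ] {A E F : Set α} {b : ℝ}
    (h : |μ.real (E ∩ A ∩ F) * μ.real (A ∩ univ) - μ.real (E ∩ A ∩ univ) * μ.real (A ∩ F)| ≤
      b * μ.real (A ∩ F) * μ.real (A ∩ univ)) :
    |μ.real (E ∩ A ∩ F) - μ.real (E ∩ A) / μ.real A * μ.real (A ∩ F)| ≤ b * μ.real (A ∩ F) := by
  simp only [inter_univ] at h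
  exact quenched_of_abs_crossMul_le μ h

end Summit.CriticalPhenomena.CardyFormulaZ2.Cruxes.NestingRigidity.PinchResampling
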